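import Summits.QuantumFields.QCD.Theorems.QuarksAsStableActionStableActionBridgeFermionSlicePosDef
import Summits.QuantumFields.QCD.Theorems.QuarksAsStableActionStableActionBridgeGaugeKernelFockForm
import Summits.QuantumFields.QCD.Theorems.QuarksAsStableActionStableActionBridgeFermionSliceContinuous
import Summits.QuantumFields.QCD.Theorems.QuarksAsStableActionStableActionBridgeGaugeKernelBounds
import Summits.QuantumFields.QCD.Theorems.QuarksAsStableActionStableActionBridgeKernelDoubleIntegral
import Summits.QuantumFields.QCD.Theorems.QuarksAsStableActionStableActionBridgePosSemidefRayleigh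

/-!
# The QCD transfer operator as a positive, bounded quadratic form (crux `QuarksAsStableAction.StableActionBridge`,
item stmt-QuantumFields-9737, line `Sketch`; lead assembly of continuation lead c5, cycle 6, `--supports stmt-QuantumFields-9737`;
registered sub-goals `transferForm_self_nonneg`, `transferRayleigh_nonneg`, `transferRayleigh_le`)

`Literature/MathematicalPhysics/QuantumFieldTheory/QCDTransferMatrix.lean` renders Lüscher's transfer matrix of lattice QCD with
`r = 1` Wilson quarks (Smit's explicit form `T̂ = T̂_F^{1/2} T̂_U T̂_F^{1/2}`) WITHOUT operator theory, through two sesquilinear forms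
on Fock-vector-valued wave functions `Ψ : SU(3)^{Edge 3 S} → Fock` of one time slice:
the weighted pairing `𝔫(Φ, Ψ) = ∫ ⟨Φ(U), T̂_F(U) Ψ(U)⟩ dU` (`fermionWeightForm`) and the transfer form
`𝔱(Φ, Ψ) = ∫∫ K_β(U, U') ⟨T̂_F(U) Φ(U), T̂_F(U') Ψ(U')⟩ dU dU'` (`transferForm`), whose Rayleigh quotient
`R(Ψ) = Re 𝔱(Ψ,Ψ) / Re 𝔫(Ψ,Ψ)` (`transferRayleigh`) defines the min–max levels `qcdTransferLevel` and the gap `qcdTransferGap`.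
The docstrings there assert, citing Lüscher 1977, that `T̂` is bounded, self-adjoint and positive. This file proves the
form-level content of "positive" and "bounded" for `β ≥ 0` and all `m_f > −1`:

* `transferForm_self_nonneg` — `Re 𝔱(Ψ, Ψ) ≥ 0`, `Im 𝔱(Ψ, Ψ) = 0` for every continuous wave `Ψ` (`T̂ ≥ 0`): the Fock-valued
  positivity of the Wilson gauge kernel (`gaugeSliceKernel_quadForm_dotProduct_nonneg`, p126819) applied to the continuous,
  hence bounded measurable, family `χ(U) = T̂_F(U) Ψ(U)` (`continuous_fermionSliceOp`, p126836);
* `transferRayleigh_nonneg` — `R(Ψ) ≥ 0` (with `Re 𝔫(Ψ,Ψ) ≥ 0`, `fermionWeightForm_self_re_nonneg`, p120035);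
* `transferRayleigh_le` — **`T̂` is bounded**: there is `Λ ≥ 0` with `R(Ψ) ≤ Λ` for every continuous `Ψ`.  Proof:
  `Re 𝔱(Ψ,Ψ) ≤ ∫ ‖T̂_F(U)Ψ(U)‖² dU` since `0 ≤ K_β ≤ 1` on a probability measure (`gaugeSliceKernel_le_one` p126750,
  `re_double_integral_kernel_dotProduct_le` p126790), and pointwise `‖T̂_F v‖² ≤ Λ ⟨v, T̂_F v⟩` for the positive matrix
  `T̂_F(U) ≤ Λ` (`re_dotProduct_mulVec_mulVec_le_of_posSemidef`, `re_dotProduct_mulVec_le_sum_norm`, p126797), where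
  `Λ = max_U Σ_{ij} ‖T̂_F(U)_{ij}‖` exists by continuity on the compact configuration space.

These are the inputs of the order structure of the min–max levels (`qcdTransferLevel_antitone`, `qcdTransferLevel_zero_pos_and_le`,
next file) — the operator/form level of F3 (Lüscher's transfer-matrix formalism) in the census of this crux.

References: M. Lüscher, Commun. Math. Phys. 54 (1977) 283 [Luscher1977, pp. 283–292]; J. Smit, *Introduction to Quantum
Fields on a Lattice*, §4.6 (4.121)–(4.137), §6.5 (6.87)–(6.91) [Smit2023]; M. Reed, B. Simon, *Methods of Modern Mathematical
Physics IV*, Thm XIII.1 [ReedSimonIV1978].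
-/

noncomputable section

namespace Summit.QuantumFields.QCD.Cruxes.StableActionBridge.Sketch

open scoped ComplexOrder
open MeasureTheory Matrix Literature.MathematicalPhysics.QuantumFieldTheory Literature.MathematicalPhysics.QuantumLattice

/-! ## Lead assembly -/

/-- The product Haar measure on the slice link variables is a probability measure (stated as a theorem, not an
instance, to keep this file definition-free; use `haveI := isProbabilityMeasure_sliceHaar S`). [folklore] -/
theorem isProbabilityMeasure_sliceHaar (S : ℕ) [NeZero S] : IsProbabilityMeasure (sliceHaar S) := by
  unfold sliceHaar; infer_instance

/-- A continuous function on the (compact, second-countable) slice configuration space is bounded. [folklore] -/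
theorem exists_bound_of_continuous_slice {S : ℕ} [NeZero S] {E : Type} [NormedAddCommGroup E]
    {f : GaugeConfig 3 S (Matrix.specialUnitaryGroup (Fin 3) ℂ) → E} (hf : Continuous f) :
    ∃ C : ℝ, ∀ U, ‖f U‖ ≤ C := by
  obtain ⟨C, hC⟩ := isCompact_univ.exists_bound_of_continuousOn hf.continuousOn
  exact ⟨C, fun U => hC U (Set.mem_univ U)⟩

/-- A continuous complex function on the slice configuration space is Haar integrable. [folklore] -/
theorem integrable_sliceHaar_of_continuous {S : ℕ} [NeZero S]
    {f : GaugeConfig 3 S (Matrix.specialUnitaryGroup (Fin 3) ℂ) → ℂ} (hf : Continuous f) :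
    Integrable f (sliceHaar S) := by
  haveI := isProbabilityMeasure_sliceHaar S
  obtain ⟨C, hC⟩ := exists_bound_of_continuous_slice hf
  exact (integrable_const C).mono' hf.aestronglyMeasurable (Filter.Eventually.of_forall hC)

/-- **Positivity of the transfer form on the diagonal** (registered sub-goal `transferForm_self_nonneg`; `T̂ ≥ 0` as a
quadratic form): for `β ≥ 0`, all `m_f > −1` and every continuous wave function `Ψ`,
`Re 𝔱(Ψ, Ψ) = Re ∫∫ K_β(U,U') ⟨T̂_F(U)Ψ(U), T̂_F(U')Ψ(U')⟩ ≥ 0` and `Im 𝔱(Ψ, Ψ) = 0` — the Fock-valued positivity of the Wilson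
gauge kernel applied to the continuous (hence bounded, measurable) family `χ(U) = T̂_F(U)Ψ(U)`.
[cite: Luscher1977, pp. 283–292] [cite: Smit2023, §6.5 (6.87)] -/
theorem transferForm_self_nonneg : ∀ (Nf S : ℕ) [NeZero S] (β : ℝ) (mq : Fin Nf → ℝ), 0 ≤ β → (∀ f, -1 < mq f) → ∀ Ψ : SliceWave Nf S, Continuous Ψ → 0 ≤ (transferForm β mq Ψ Ψ).re ∧ (transferForm β mq Ψ Ψ).im = 0 := by
  intro Nf S _ β mq hβ hm Ψ hΨ
  haveI := isProbabilityMeasure_sliceHaar S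
  have hχ : Continuous fun U : GaugeConfig 3 S (Matrix.specialUnitaryGroup (Fin 3) ℂ) =>
      fermionSliceOp U mq *ᵥ Ψ U :=
    (continuous_fermionSliceOp Nf S mq hm).matrix_mulVec hΨ
  obtain ⟨C, hC⟩ := exists_bound_of_continuous_slice hχ
  exact gaugeSliceKernel_quadForm_dotProduct_nonneg S β hβ (Finset (SliceFermiIdx Nf S)) (sliceHaar S)
    (fun U => fermionSliceOp U mq *ᵥ Ψ U) ⟨C, fun U i => (norm_le_pi_norm _ i).trans (hC U)⟩
    fun i => ((continuous_apply i).comp hχ).measurable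

/-- **The Rayleigh quotient of the QCD transfer operator is non-negative** on continuous waves (registered sub-goal
`transferRayleigh_nonneg`): `R(Ψ) = Re 𝔱(Ψ,Ψ) / Re 𝔫(Ψ,Ψ) ≥ 0` for `β ≥ 0`, `m_f > −1` (both real parts are `≥ 0`; Lean's
`x / 0 = 0` covers the degenerate denominator). [cite: Luscher1977, pp. 283–292] [cite: ReedSimonIV1978, Thm XIII.1] -/
theorem transferRayleigh_nonneg : ∀ (Nf S : ℕ) [NeZero S] (β : ℝ) (mq : Fin Nf → ℝ), 0 ≤ β → (∀ f, -1 < mq f) → ∀ Ψ : SliceWave Nf S, Continuous Ψ → 0 ≤ transferRayleigh β mq Ψ := by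
  intro Nf S _ β mq hβ hm Ψ hΨ
  unfold transferRayleigh
  exact div_nonneg (transferForm_self_nonneg Nf S β mq hβ hm Ψ hΨ).1
    (fermionWeightForm_self_re_nonneg Nf S mq hm Ψ)

/-- `Re ⟨v, v⟩ ≥ 0` for the `star`-dot product. [folklore] -/
theorem re_star_dotProduct_self_nonneg {n : Type} [Fintype n] (v : n → ℂ) : 0 ≤ (star v ⬝ᵥ v).re := by
  rw [dotProduct, Complex.re_sum]
  refine Finset.sum_nonneg fun i _ => ?_
  rw [Pi.star_apply, Complex.star_def, Complex.conj_mul' ]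
  exact_mod_cast sq_nonneg ‖v i‖

/-- **The QCD transfer operator is bounded** (registered sub-goal `transferRayleigh_le`): for `β ≥ 0` and all `m_f > −1`
there is `Λ ≥ 0` with `R(Ψ) ≤ Λ` for every continuous wave function `Ψ` — so the min–max levels `qcdTransferLevel` are
suprema of bounded sets.  `Λ = max_U Σ_{ij} ‖T̂_F(U)_{ij}‖`; `Re 𝔱(Ψ,Ψ) ≤ ∫ ‖T̂_F(U)Ψ(U)‖² dU ≤ Λ · Re 𝔫(Ψ,Ψ)` by
`0 ≤ K_β ≤ 1` on the probability measure `sliceHaar` and `T̂_F(U)² ≤ Λ T̂_F(U)`.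
[cite: Luscher1977, pp. 283–292] [cite: Smit2023, §6.5 (6.87)–(6.91)] [cite: ReedSimonIV1978, Thm XIII.1] -/
theorem transferRayleigh_le : ∀ (Nf S : ℕ) [NeZero S] (β : ℝ) (mq : Fin Nf → ℝ), 0 ≤ β → (∀ f, -1 < mq f) → ∃ Λ : ℝ, 0 ≤ Λ ∧ ∀ Ψ : SliceWave Nf S, Continuous Ψ → transferRayleigh β mq Ψ ≤ Λ := by
  intro Nf S _ β mq hβ hm
  haveI := isProbabilityMeasure_sliceHaar S
  have hT := continuous_fermionSliceOp Nf S mq hm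
  -- the entrywise ℓ¹ bound of `T̂_F(U)` is continuous in `U`, hence bounded on the compact configuration space
  have hL : Continuous fun U : GaugeConfig 3 S (Matrix.specialUnitaryGroup (Fin 3) ℂ) =>
      ∑ i, ∑ j, ‖fermionSliceOp (Nf := Nf) U mq i j‖ :=
    continuous_finsetSum _ fun i _ => continuous_finsetSum _ fun j _ =>
      ((continuous_apply j).comp ((continuous_apply i).comp hT)).norm
  obtain ⟨Λ, hΛ⟩ := exists_bound_of_continuous_slice hL
  have hΛ' : ∀ U, ∑ i, ∑ j, ‖fermionSliceOp (Nf := Nf) U mq i j‖ ≤ Λ := fun U =>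
    (Real.le_norm_self _).trans (hΛ U)
  have hΛ0 : 0 ≤ Λ := (Finset.sum_nonneg fun i _ => Finset.sum_nonneg fun j _ => norm_nonneg _).trans
    (hΛ' (fun _ => 1))
  refine ⟨Λ, hΛ0, fun Ψ hΨ => ?_⟩
  -- pointwise form bound `Re⟨v, T̂_F(U) v⟩ ≤ Λ ‖v‖²` and its consequence `Re⟨T̂_F v, T̂_F v⟩ ≤ Λ Re⟨v, T̂_F v⟩`
  have hform : ∀ (U : GaugeConfig 3 S (Matrix.specialUnitaryGroup (Fin 3) ℂ)) (v : Finset (SliceFermiIdx Nf S) → ℂ),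
      (star v ⬝ᵥ (fermionSliceOp U mq *ᵥ v)).re ≤ Λ * (star v ⬝ᵥ v).re := fun U v =>
    (re_dotProduct_mulVec_le_sum_norm _ (fermionSliceOp U mq) v).trans
      (mul_le_mul_of_nonneg_right (hΛ' U) (re_star_dotProduct_self_nonneg v))
  have hsq : ∀ U : GaugeConfig 3 S (Matrix.specialUnitaryGroup (Fin 3) ℂ),
      (star (fermionSliceOp U mq *ᵥ Ψ U) ⬝ᵥ (fermionSliceOp U mq *ᵥ Ψ U)).re ≤
        Λ * (star (Ψ U) ⬝ᵥ (fermionSliceOp U mq *ᵥ Ψ U)).re := fun U =>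
    re_dotProduct_mulVec_mulVec_le_of_posSemidef _ (fermionSliceOp U mq) Λ
      (fermionSliceOp_posDef Nf S U mq hm).posSemidef (hform U) (Ψ U)
  -- the numerator: `Re 𝔱(Ψ,Ψ) ≤ ∫ ‖T̂_F(U)Ψ(U)‖² dU ≤ Λ Re 𝔫(Ψ,Ψ)`
  have hχ : Continuous fun U : GaugeConfig 3 S (Matrix.specialUnitaryGroup (Fin 3) ℂ) =>
      fermionSliceOp U mq *ᵥ Ψ U := hT.matrix_mulVec hΨ
  obtain ⟨C, hC⟩ := exists_bound_of_continuous_slice hχ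
  have hK : Measurable (Function.uncurry (gaugeSliceKernel (S := S) β)) :=
    (continuous_gaugeSliceKernel S β).measurable
  have hnum : (transferForm β mq Ψ Ψ).re ≤
      ∫ U, (star (fermionSliceOp U mq *ᵥ Ψ U) ⬝ᵥ (fermionSliceOp U mq *ᵥ Ψ U)).re ∂(sliceHaar S) :=
    re_double_integral_kernel_dotProduct_le _ (sliceHaar S) (Finset (SliceFermiIdx Nf S))
      (gaugeSliceKernel β) (fun U => fermionSliceOp U mq *ᵥ Ψ U)
      (fun U U' => (gaugeSliceKernel_pos β U U').le) (gaugeSliceKernel_le_one S β hβ) hK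
      ⟨C, fun U i => (norm_le_pi_norm _ i).trans (hC U)⟩ fun i => ((continuous_apply i).comp hχ).measurable
  have hdiag : Continuous fun U : GaugeConfig 3 S (Matrix.specialUnitaryGroup (Fin 3) ℂ) =>
      star (Ψ U) ⬝ᵥ (fermionSliceOp U mq *ᵥ Ψ U) := (hΨ.star).dotProduct hχ
  have hint2 : (transferForm β mq Ψ Ψ).re ≤ Λ * (fermionWeightForm mq Ψ Ψ).re := by
    refine hnum.trans ?_
    have h1 : ∫ U, (star (fermionSliceOp U mq *ᵥ Ψ U) ⬝ᵥ (fermionSliceOp U mq *ᵥ Ψ U)).re ∂(sliceHaar S) ≤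
        ∫ U, Λ * (star (Ψ U) ⬝ᵥ (fermionSliceOp U mq *ᵥ Ψ U)).re ∂(sliceHaar S) :=
      integral_mono (integrable_sliceHaar_of_continuous ((hχ.star).dotProduct hχ)).re
        ((integrable_sliceHaar_of_continuous hdiag).re.const_mul Λ) hsq
    refine h1.trans (le_of_eq ?_)
    rw [integral_const_mul, fermionWeightForm]
    congr 1
    have h := integral_re (integrable_sliceHaar_of_continuous hdiag)
    simpa only [RCLike.re_to_complex] using h
  -- conclude
  unfold transferRayleigh
  have hden := fermionWeightForm_self_re_nonneg Nf S mq hm Ψ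
  rcases hden.eq_or_lt with h0 | hpos
  · rw [← h0, div_zero]; exact hΛ0
  · rw [div_le_iff₀ hpos]; exact hint2

end Summit.QuantumFields.QCD.Cruxes.StableActionBridge.Sketch

end
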